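import Summits.CriticalPhenomena.PercolationContinuityZ3.Theorems.Transplant.GrigorchukLamplighterStandardGensNoSkeleton
import Summits.CriticalPhenomena.PercolationContinuityZ3.Theorems.Transplant.GrigorchukBurnside
import Literature.GroupTheory.Nilpotent.TorsionNilpotent
import Mathlib.GroupTheory.Schreier
import Mathlib.GroupTheory.Nilpotent
import HarnessLib

/-!
# `𝔊` is NOT virtually nilpotent (kernel), and NO virtually nilpotent group acts with finitely many orbits by automorphisms on `Cay(ℤ ≀_X 𝔊; a, b, c, d, s)` —
# the Aut-level twin (α-Q) of «GrigorchukLamplighterNotVirtuallyNilpotent»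

builds on p205010 (kernel theorem, internal audit signed; external expert review pending) — nothing in this file uses p205010.  NEGATIVE (scope) record about the
INPUT of the quasi-step node's Cayley / action customers (`AutCyl.conj4_of_virtuallyNilpotent_cocompact` &c. need a virtually nilpotent group acting with
finitely many orbits); no percolation statement; nothing about any `@[conjecture]`, in particular nothing about `BenjaminiSchramm1996_conj4_endState`; NOTHING
about growth (Gromov's theorem is neither used nor needed).  Lane `prim-bschramm`, seat `prim-bschramm-p3` gen 36 (DESIGN OWNER; `P3-NILPOTENT.md` §29.4 /
located item L-p5g31-3 of the refuter, lead g25 ruling #7787).  Helper file (`--supports stmt-CriticalPhenomena-4575 --as helper`).  Def-free.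

CONTENT.
* §1 `Grigorchuk.not_isNilpotent_of_finiteIndex` — no finite-index subgroup of `𝔊` is nilpotent: it would be finitely generated (Schreier, Mathlib) and TORSION
  (Grigorchuk's theorem, kernel p591617), hence FINITE by Baer («Literature/GroupTheory/Nilpotent/TorsionNilpotent» `finite_of_fg_of_isTorsion`), making `𝔊` finite —
  but `𝔊` is infinite (p594312 `grigorchukGroup_infinite`).  Hence `not_isVirtuallyNilpotent_grigorchukGroup`.
* §2 `Grigorchuk.treeHom` calculus for a group `A` acting on `Γ₂` by automorphisms of `Cay` (a `LabelAction` by «GrigorchukLamplighterStandardGensNoSkeleton»):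
  the tree-part homomorphism `A →* ↥grigorchukGroup` (F2a's `treePart`, read in `𝔊`) has FINITE-INDEX IMAGE as soon as `A` has finitely many orbits (the cover
  at the tree vertices).
* §3 **`Grigorchuk.cay_no_virtuallyNilpotent_finite_orbits`**: no group with a finite-index nilpotent subgroup acts on `Γ₂` by automorphisms of `Cay` with
  finitely many orbits — at the level of `Aut(Cay)`, not only of subgroups of `Γ₂` (p595064).  (The image of the nilpotent finite-index subgroup would be a
  finite-index nilpotent subgroup of `𝔊`.)
[cite: Grigorchuk1980, every element of 𝔊 has finite order] [cite: BartholdiErschler2012, §2–§3.1] [cite: BenjaminiSchramm1996, Conj. 4; §2]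
-/

noncomputable section

namespace Summit.CriticalPhenomena.PercolationContinuityZ3.Theorems.Transplant

namespace Grigorchuk

open SimpleGraph SemidirectProduct Literature.Probability.Percolation
open scoped Classical

/-! ### §1 `𝔊` has no nilpotent subgroup of finite index -/

/-- An element of a subgroup has finite order if its image does. [folklore] -/
theorem isOfFinOrder_of_coe {G : Type} [Group G] {K : Subgroup G} (k : K) (hk : IsOfFinOrder (k : G)) : IsOfFinOrder k := by
  obtain ⟨n, hn, h⟩ := hk.exists_pow_eq_one
  exact isOfFinOrder_iff_pow_eq_one.2 ⟨n, hn, Subtype.ext (by rw [Subgroup.coe_pow, h, Subgroup.coe_one])⟩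

/-- `𝔊` is a torsion group, as a statement about the subtype. [cite: Grigorchuk1980, every element of 𝔊 has finite order] -/
theorem isTorsion_grigorchukGroup : Monoid.IsTorsion ↥grigorchukGroup := fun g =>
  isOfFinOrder_of_coe g (isOfFinOrder_of_mem g.2)

/-- `𝔊` is infinite, as a statement about the subtype. [cite: Grigorchuk1980, 𝔊 is infinite] -/
theorem infinite_grigorchukGroup : Infinite ↥grigorchukGroup := Set.infinite_coe_iff.2 grigorchukGroup_infinite

/-- **No finite-index subgroup of `𝔊` is nilpotent** (f.g. by Schreier, torsion by Grigorchuk, hence finite by Baer — but `𝔊` is infinite).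
[cite: Grigorchuk1980, every element of 𝔊 has finite order] -/
theorem not_isNilpotent_of_finiteIndex (K : Subgroup ↥grigorchukGroup) [K.FiniteIndex] : ¬ Group.IsNilpotent K := by
  intro hK
  haveI : Group.FG ↥grigorchukGroup := by
    show Group.FG ↥(Subgroup.closure ({genA, genB, genC, genD} : Set (Equiv.Perm Ray)))
    infer_instance
  haveI : Group.FG K := Subgroup.fg_of_index_ne_zero K
  have htor : Monoid.IsTorsion K := fun k => isOfFinOrder_of_coe k (isTorsion_grigorchukGroup k)
  haveI : Finite K := Literature.GroupTheory.Nilpotent.finite_of_fg_of_isTorsion htor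
  haveI : Finite ↥grigorchukGroup := by
    refine Nat.finite_of_card_ne_zero ?_
    rw [← K.index_mul_card]
    exact Nat.mul_ne_zero Subgroup.FiniteIndex.index_ne_zero (Nat.card_pos (α := K)).ne'
  haveI := infinite_grigorchukGroup
  exact not_finite ↥grigorchukGroup

/-- **`𝔊` is not virtually nilpotent.** [cite: Grigorchuk1980, every element of 𝔊 has finite order] -/
theorem not_isVirtuallyNilpotent_grigorchukGroup : ¬ Group.IsVirtuallyNilpotent ↥grigorchukGroup := by
  rintro ⟨K, hK, hfi⟩
  haveI := hfi
  exact not_isNilpotent_of_finiteIndex K hK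

/-! ### §2 The tree-part homomorphism of an action by automorphisms, read in `𝔊` -/

/-- The frame's decomposition maps are `lamW`, `trW`; its tree subgroup is `treesW`. [folklore] -/
theorem frameW_tr (γ : ↥wreathZ) : frameW.tr γ = trW γ ∧ frameW.lam γ = lamW γ := ⟨rfl, rfl⟩

section Action

variable {A : Type} [Group A] [MulAction A ↥wreathZ]

/-- **The tree-part homomorphism `A → 𝔊`** of a label-preserving action (F2a's `treePart` followed by the tree projection). [folklore] -/
theorem exists_treeHom (hA : frameW.LabelAction A) :
    ∃ τ : A →* ↥grigorchukGroup, ∀ a : A, ((τ a : ↥grigorchukGroup) : Equiv.Perm Ray) = (((hA.treePart a : ↥wreathZ)) : LampGroup ℤ).right := by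
  refine ⟨MonoidHom.mk' (fun a => ⟨(((hA.treePart a : ↥wreathZ)) : LampGroup ℤ).right, right_mem_grigorchukGroup (hA.treePart a).2⟩)
    (fun a b => Subtype.ext ?_), fun a => rfl⟩
  show (((hA.treePart (a * b) : ↥wreathZ)) : LampGroup ℤ).right =
    (((hA.treePart a : ↥wreathZ)) : LampGroup ℤ).right * (((hA.treePart b : ↥wreathZ)) : LampGroup ℤ).right
  rw [hA.treePart_mul, Subgroup.coe_mul, mul_right]

/-- **With finitely many orbits the tree-part image has finite index in `𝔊`**: every `g ∈ 𝔊` is `τ(a) · (tr r).right` for a representative `r` (the cover at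
the tree vertex `g⁻¹`), so the finitely many `(tr r).right⁻¹` hit every left coset of the image. [folklore] -/
theorem finiteIndex_range_treeHom (hA : frameW.LabelAction A) {τ : A →* ↥grigorchukGroup}
    (hτ : ∀ a : A, ((τ a : ↥grigorchukGroup) : Equiv.Perm Ray) = (((hA.treePart a : ↥wreathZ)) : LampGroup ℤ).right) (R : Finset ↥wreathZ)
    (hRc : ∀ γ : ↥wreathZ, ∃ a : A, ∃ r ∈ R, a • r = γ) : τ.range.FiniteIndex := by
  let ρ : ↥R → ↥grigorchukGroup := fun r => ⟨(((r : ↥wreathZ) : LampGroup ℤ).right)⁻¹, grigorchukGroup.inv_mem (right_mem_grigorchukGroup r.1.2)⟩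
  haveI : Finite (↥grigorchukGroup ⧸ τ.range) := by
    refine Finite.of_surjective (fun r : ↥R => (QuotientGroup.mk (ρ r) : ↥grigorchukGroup ⧸ τ.range)) fun q => ?_
    induction q using QuotientGroup.induction_on with
    | H g =>
      obtain ⟨a, r, hr, har⟩ := hRc ⟨tree ((g : Equiv.Perm Ray))⁻¹, tree_mem_wreathZ (grigorchukGroup.inv_mem g.2)⟩
      refine ⟨⟨r, hr⟩, ?_⟩
      rw [QuotientGroup.eq]
      -- `tr (a • r) = treePart a · tr r`, read in `Perm Ray`: `g⁻¹ = τ a · r.right`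
      have e := hA.tr_smul a r
      rw [har, (frameW_tr _).1, (frameW_tr _).1] at e
      have e' : ((g : Equiv.Perm Ray))⁻¹ = ((τ a : ↥grigorchukGroup) : Equiv.Perm Ray) * ((r : LampGroup ℤ)).right := by
        have h := congrArg (fun π : ↥wreathZ => ((π : LampGroup ℤ)).right) e
        simp only [trW, Subgroup.coe_mul, mul_right, right_inr, tree_right] at h
        rw [hτ]; exact h
      have e'' : ((τ a : ↥grigorchukGroup) : Equiv.Perm Ray) = ((g : Equiv.Perm Ray))⁻¹ * (((r : LampGroup ℤ)).right)⁻¹ :=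
        eq_mul_inv_of_mul_eq e'.symm
      refine ⟨a⁻¹, Subtype.ext ?_⟩
      rw [map_inv]
      show (((τ a : ↥grigorchukGroup) : Equiv.Perm Ray))⁻¹ = ((((r : ↥wreathZ) : LampGroup ℤ).right)⁻¹)⁻¹ * (g : Equiv.Perm Ray)
      rw [e'', mul_inv_rev, inv_inv, inv_inv]
  exact Subgroup.finiteIndex_of_finite_quotient

/-! ### §3 No virtually nilpotent group acts with finitely many orbits -/

/-- **(α-Q) NO VIRTUALLY NILPOTENT GROUP ACTS ON `Γ₂` BY AUTOMORPHISMS OF `Cay(ℤ ≀_X 𝔊; a,b,c,d,s)` WITH FINITELY MANY ORBITS** — the input of the quasi-step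
node's action customers (rung Q) is absent from B–E's Cayley graph at the level of `Aut(Cay)`, not only of subgroups of `Γ₂` (p595064).  (The image of the
nilpotent finite-index subgroup under the tree-part homomorphism would be a finite-index nilpotent subgroup of `𝔊`.)  `θ(p_c) = 0` on this graph stays NOT PROVED.
[cite: BartholdiErschler2012, §2–§3.1] [cite: Grigorchuk1980, every element of 𝔊 has finite order] [cite: BenjaminiSchramm1996, Conj. 4; §2] -/
theorem cay_no_virtuallyNilpotent_finite_orbits (hact : IsActionByAut Cay A) (R : Finset ↥wreathZ)
    (hRc : ∀ γ : ↥wreathZ, ∃ a : A, ∃ r ∈ R, a • r = γ) (N : Subgroup A) [N.FiniteIndex] : ¬ Group.IsNilpotent N := by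
  intro hN
  have hA := labelAction_of_isActionByAut hact
  obtain ⟨τ, hτ⟩ := exists_treeHom hA
  haveI := finiteIndex_range_treeHom hA hτ R hRc
  -- the image of `N` is nilpotent and of finite index in `𝔊`
  haveI : Group.IsNilpotent (N.map τ) := by
    refine Group.nilpotent_of_surjective ((τ.restrict N).codRestrict (N.map τ) fun x => ⟨x, x.2, rfl⟩) ?_
    rintro ⟨_, x, hx, rfl⟩
    exact ⟨⟨x, hx⟩, rfl⟩
  haveI : (N.map τ).FiniteIndex := by
    refine ⟨?_⟩
    rw [Subgroup.index_map]
    refine Nat.mul_ne_zero ?_ Subgroup.FiniteIndex.index_ne_zero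
    have h := Subgroup.index_dvd_of_le (le_sup_left : N ≤ N ⊔ τ.ker)
    exact fun h0 => Subgroup.FiniteIndex.index_ne_zero (Nat.eq_zero_of_zero_dvd (h0 ▸ h))
  exact not_isNilpotent_of_finiteIndex (N.map τ) inferInstance

/-- **(α-Q), virtual form**: no group `A` with `Group.IsVirtuallyNilpotent A` acts on `Γ₂` by automorphisms of `Cay` with finitely many orbits. [folklore] -/
theorem cay_not_isVirtuallyNilpotent_of_finite_orbits (hact : IsActionByAut Cay A) (R : Finset ↥wreathZ)
    (hRc : ∀ γ : ↥wreathZ, ∃ a : A, ∃ r ∈ R, a • r = γ) : ¬ Group.IsVirtuallyNilpotent A := by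
  rintro ⟨N, hN, hfi⟩
  haveI := hfi
  exact cay_no_virtuallyNilpotent_finite_orbits hact R hRc N hN

end Action

end Grigorchuk

end Summit.CriticalPhenomena.PercolationContinuityZ3.Theorems.Transplant
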